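import Literature.Probability.RandomPlanarGeometry.LoewnerMoebiusImageChain
import Literature.Probability.RandomPlanarGeometry.LoewnerRealPointProofs
import Summits.CriticalPhenomena.SAWScalingLimit.Theorems.SAWRenewalTightnessSubseqIdentificationCompensatorVerticalSlit
import HarnessLib

/-!
# Semicircle steering of the Loewner chain into a hull (line `boundary-area-law`, stub L3a-A)

Line `boundary-area-law` of the crux `SubseqIdentification` (stmt-CriticalPhenomena-0783), lead c5
reshape r-c5-1, registered stub `stub_steeringArc`. For a `*`-hull `A` with a point
`z₀ ∈ A ∩ ℍ` off the imaginary axis and any level `q` we construct an explicit continuous driving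
function `U` from `0`, a time `S` and a point `a ∈ A ∩ ℍ` such that every point of `A` is alive at
time `S` under the chain of `U`, while `∫_{(0,S]} (Im Z_s/|Z_s|²)²/2 ds ≥ q`,
`Z_s = g^U_s(a) - U_s`.

The chain is the **semicircle** from `0` to the first point `a = N(i y⋆)` of `A` on the circle
through `0` and `z₀` orthogonal to `ℝ`: the image (`MoebiusPole.imageDriver`,
`hull_imageDriver_eq`, `map_imageDriver_apply` of `LoewnerMoebiusImageChain`) of the vertical slit
(zero driver, `map_zeroDriver_I_mul`) under the real Möbius map `N(z) = a + b/(p - z)` of `ℍ` with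
`N(0) = 0` and `N(i y₁) = z₀` (`exists_moebParams_c5`); `y⋆ ≤ y₁` is the first hit
(`exists_firstHit_c5`). Aliveness: points of `A ∩ ℍ` pull back under `N` to points off the slit
`{iy : y < y⋆}` ⊇ hull (`re_eq_zero_of_mem_hull_zeroDriver_c5`); real points of `A` are nonzero,
hence off the closed semicircle (`Loewner.lt_swallowingTime_of_notMem_closure_hull_holds`).
The integral: `Z_{clock u} = h_u(i√(y⋆² - 4u)) - h_u(0)`, `h_u = conjMap`, and
`(Im Z/|Z|²)²/2 = P⁴/(2b²d₁²(y⋆² - 4u))` (`sq_im_div_normSq_conjMap_c5`: with `P = poleFlow = gap`,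
`d₁ = poleDeriv`), which against the clock rate `(b d₁/P²)²` is `1/(2(y⋆² - 4u))`; by the change of
variables along the clock (`MoebiusPole.integral_comp_invClock`) the integral is
`(1/8) log (y⋆²/(y⋆² - 4u_q)) ≥ q` (`integral_inv_two_mul_sub_c5`, `exists_steerTime_c5`).

References: G. F. Lawler, *Conformally Invariant Processes in the Plane* (2005), §4.1, §4.6.1, §6.3;
G. F. Lawler, O. Schramm, W. Werner, *Conformal restriction: the chordal case*, J. Amer. Math. Soc.
16 (2003), §8. No unproved named fact is used. -/

noncomputable section

open MeasureTheory Filter Topology Set Metric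
open scoped NNReal ENNReal
open Literature.Probability.RandomPlanarGeometry
open UpperHalfPlane (upperHalfPlaneSet)

namespace Summit.CriticalPhenomena.SAWScalingLimit.Theorems.SubseqIdentification.BoundaryAreaLaw

open Loewner MoebiusPole Complex

/-- **The steering Möbius map through `z₀`.** For `z₀ = x₀ + i v₀`, `v₀ > 0`, `x₀ ≠ 0`:
`b = x₀² + v₀²`, `p = -x₀`, `a = b/x₀`, `y₁ = x₀²/v₀` give `b > 0`, `p ≠ 0`, `a + b/p = 0`
(`N(0) = 0` for `N(z) = a + b/(p - z)`) and `N(i y₁) = z₀`. [folklore] -/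
theorem exists_moebParams_c5 {z₀ : ℂ} (hv : 0 < z₀.im) (hx : z₀.re ≠ 0) :
    ∃ a b p y₁ : ℝ, 0 < b ∧ p ≠ 0 ∧ a + b / p = 0 ∧ 0 < y₁ ∧ moebN a b p (I * y₁) = z₀ := by
  set x₀ := z₀.re
  set v₀ := z₀.im
  have hb : 0 < x₀ ^ 2 + v₀ ^ 2 := by positivity
  refine ⟨(x₀ ^ 2 + v₀ ^ 2) / x₀, x₀ ^ 2 + v₀ ^ 2, -x₀, x₀ ^ 2 / v₀, hb, neg_ne_zero.2 hx, ?_,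
    by positivity, ?_⟩
  · field_simp
    ring
  · have hv0 : v₀ ≠ 0 := hv.ne'
    rw [moebN]
    apply Complex.ext
    · simp only [Complex.add_re, Complex.ofReal_re, Complex.div_re, Complex.sub_re, Complex.mul_re,
        Complex.I_re, Complex.I_im, Complex.ofReal_im, Complex.sub_im, Complex.mul_im,
        Complex.normSq_apply, zero_mul, one_mul, sub_zero, zero_sub, mul_zero]
      field_simp
      ring
    · simp only [Complex.add_im, Complex.ofReal_im, Complex.div_im, Complex.sub_re, Complex.mul_re,
        Complex.I_re, Complex.I_im, Complex.ofReal_re, Complex.ofReal_im, Complex.sub_im,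
        Complex.mul_im, Complex.normSq_apply, zero_mul, one_mul, sub_zero, zero_sub, mul_zero,
        zero_add]
      field_simp
      ring

/-- **First hit.** A continuous curve `f` with `f 0 = 0 ∉ A`, `A` closed, meeting `A` at the
parameter `y₁ ≥ 0` has a first hitting parameter `y⋆ ∈ (0, y₁]`. [folklore] -/
theorem exists_firstHit_c5 {A : Set ℂ} (hA : IsClosed A) (h0 : (0 : ℂ) ∉ A) {f : ℝ → ℂ}
    (hf : Continuous f) (hf0 : f 0 = 0) {y₁ : ℝ} (hy₁ : 0 ≤ y₁) (hmem : f y₁ ∈ A) :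
    ∃ y, 0 < y ∧ y ≤ y₁ ∧ f y ∈ A ∧ ∀ y', 0 < y' → y' < y → f y' ∉ A := by
  set T : Set ℝ := Icc 0 y₁ ∩ f ⁻¹' A with hT
  have hTc : IsCompact T := isCompact_Icc.inter_right (hA.preimage hf)
  obtain ⟨⟨h0le, hle1⟩, hinA⟩ := hTc.sInf_mem ⟨y₁, ⟨hy₁, le_rfl⟩, hmem⟩
  have hinA' : f (sInf T) ∈ A := hinA
  have hne0 : sInf T ≠ 0 := fun h ↦ by
    rw [h, hf0] at hinA'
    exact h0 hinA'
  refine ⟨sInf T, lt_of_le_of_ne h0le (Ne.symm hne0), hle1, hinA', fun y' hy' hy'lt hy'A ↦ ?_⟩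
  exact absurd (csInf_le hTc.bddBelow ⟨⟨hy'.le, hy'lt.le.trans hle1⟩, hy'A⟩) (not_le.2 hy'lt)

/-- **A nonzero real point is off the closed image of a parameter segment**: if `f 0 = 0`,
`Im f > 0` on `(0, ∞)`, `K ⊆ f([0, Y])`, then `x ∉ closure K` for real `x ≠ 0`. [folklore] -/
theorem ofReal_notMem_closure_of_subset_image_c5 {f : ℝ → ℂ} (hf : Continuous f) (hf0 : f 0 = 0)
    (hfim : ∀ y, 0 < y → 0 < (f y).im) {Y : ℝ} {K : Set ℂ} (hK : K ⊆ f '' Icc 0 Y) {x : ℝ}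
    (hx : x ≠ 0) : (x : ℂ) ∉ closure K := by
  intro hxK
  obtain ⟨y, ⟨hy0, -⟩, hyx⟩ := (closure_minimal hK (isCompact_Icc.image hf).isClosed) hxK
  rcases hy0.eq_or_lt with rfl | hpos
  · rw [hf0] at hyx
    exact hx (by exact_mod_cast hyx.symm)
  · have := hfim y hpos
    rw [hyx, ofReal_im] at this
    exact lt_irrefl _ this

/-- **The hull of the vertical slit lies on the imaginary segment**: a point of the hull of the
zero driver at time `t` has `Re z = 0`, `Im z > 0`, `(Im z)² ≤ 4t`
(`swallowingTime_zeroDriver_eq_top`, `le_swallowingTime_zeroDriver_I_mul`).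
[cite: Lawler2005, Ch. 4 §4.1] -/
theorem re_eq_zero_of_mem_hull_zeroDriver_c5 {t : ℝ≥0} {z : ℂ}
    (hz : z ∈ hull (fun _ : ℝ≥0 ↦ (0 : ℝ)) t) : z.re = 0 ∧ 0 < z.im ∧ z.im ^ 2 ≤ 4 * t := by
  obtain ⟨hzH, hle⟩ := hz
  have him : 0 < z.im := hzH
  have hre : z.re = 0 := by
    by_contra hre
    rw [swallowingTime_zeroDriver_eq_top hre] at hle
    exact WithTop.not_top_le_coe t hle
  refine ⟨hre, him, ?_⟩
  have hzeq : z = I * z.im := Complex.ext (by simp [hre]) (by simp)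
  have h := le_swallowingTime_zeroDriver_I_mul him
  rw [← hzeq] at h
  have h2 := WithTop.coe_le_coe.1 (h.trans hle)
  rw [Real.toNNReal_le_iff_le_coe] at h2
  linarith

/-- `Z = c/(P - iε) - c/P` (real `c, P ≠ 0, ε ≠ 0`) has `Im Z/|Z|² = P²/(cε)`. [folklore] -/
theorem im_div_normSq_sub_c5 {c P ε : ℝ} (hc : c ≠ 0) (hP : P ≠ 0) (hε : ε ≠ 0) :
    ((c : ℂ) / ((P : ℂ) - I * ε) - (c : ℂ) / (P : ℂ)).im /
        Complex.normSq ((c : ℂ) / ((P : ℂ) - I * ε) - (c : ℂ) / (P : ℂ)) = P ^ 2 / (c * ε) := by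
  have hPe : P ^ 2 + ε ^ 2 ≠ 0 := by positivity
  have hns : Complex.normSq ((P : ℂ) - I * ε) = P ^ 2 + ε ^ 2 := by
    simp [Complex.normSq_apply]; ring
  have hre : ((c : ℂ) / ((P : ℂ) - I * ε) - (c : ℂ) / (P : ℂ)).re =
      -(c * ε ^ 2) / ((P ^ 2 + ε ^ 2) * P) := by
    rw [Complex.sub_re, Complex.div_re, hns, ← Complex.ofReal_div, Complex.ofReal_re]
    simp
    field_simp
    ring
  have him : ((c : ℂ) / ((P : ℂ) - I * ε) - (c : ℂ) / (P : ℂ)).im = c * ε / (P ^ 2 + ε ^ 2) := by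
    rw [Complex.sub_im, Complex.div_im, hns, ← Complex.ofReal_div, Complex.ofReal_im]
    simp
    ring
  rw [Complex.normSq_apply, hre, him]
  field_simp
  ring

/-- **The integrand identity.** For the pole data of a gap path `X` with `P_u = X_u ≠ 0` (zero
driver: `poleFlow - gap = W = 0`) and `ε > 0`, `Z = h_u(iε) - W̃_u = h_u(iε) - h_u(0)`
(`conjMap_driving`) has `(Im Z/|Z|²)²/2 = P_u⁴/(2 b² d₁(u)² ε²)`. [cite: Lawler2005, §6.3] -/
theorem sq_im_div_normSq_conjMap_c5 {a b p : ℝ} {X : ℝ → ℝ} {u ε : ℝ} (hb : b ≠ 0)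
    (hXu : X u ≠ 0) (hPX : poleFlow p X u - X u = 0) (hε : 0 < ε) :
    ((conjMap a b p X u (I * ε) - ((driver a b X u : ℝ) : ℂ)).im /
        Complex.normSq (conjMap a b p X u (I * ε) - ((driver a b X u : ℝ) : ℂ))) ^ 2 / 2 =
      poleFlow p X u ^ 4 / (2 * b ^ 2 * poleDeriv X u ^ 2 * ε ^ 2) := by
  have hP0 : poleFlow p X u ≠ 0 := (sub_eq_zero.1 hPX) ▸ hXu
  have hd : poleDeriv X u ≠ 0 := (poleDeriv_pos u).ne'
  have hZ : conjMap a b p X u (I * ε) - ((driver a b X u : ℝ) : ℂ) =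
      ((b * poleDeriv X u : ℝ) : ℂ) / ((poleFlow p X u : ℂ) - I * ε) -
        ((b * poleDeriv X u : ℝ) : ℂ) / (poleFlow p X u : ℂ) := by
    rw [← conjMap_driving u, hPX, conjMap, conjMap, moebiusConjC_apply, moebiusConjC_apply]
    push_cast
    ring
  rw [hZ, im_div_normSq_sub_c5 (mul_ne_zero hb hd) hP0 hε.ne']
  field_simp

/-- `∫₀ᵀ dr/(2(y² - 4r)) = (1/8) log (y²/(y² - 4T))` for `0 ≤ T`, `4T < y²`. [folklore] -/
theorem integral_inv_two_mul_sub_c5 {y T : ℝ} (hT0 : 0 ≤ T) (hT : 4 * T < y ^ 2) :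
    ∫ x in (0 : ℝ)..T, 1 / (2 * (y ^ 2 - 4 * x)) = Real.log (y ^ 2 / (y ^ 2 - 4 * T)) / 8 := by
  set F : ℝ → ℝ := fun x ↦ -(Real.log (y ^ 2 - 4 * x)) / 8 with hF
  have hpos : ∀ x ∈ Icc (0 : ℝ) T, 0 < y ^ 2 - 4 * x := fun x hx ↦ by linarith [hx.2]
  have hderiv : ∀ x ∈ uIcc (0 : ℝ) T, HasDerivAt F (1 / (2 * (y ^ 2 - 4 * x))) x := by
    intro x hx
    rw [uIcc_of_le hT0] at hx
    have h1 : HasDerivAt (fun x : ℝ ↦ y ^ 2 - 4 * x) (-4) x := by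
      simpa using ((hasDerivAt_id x).const_mul (4 : ℝ)).const_sub (y ^ 2)
    refine (((h1.log (hpos x hx).ne').neg).div_const 8).congr_deriv ?_
    field_simp [(hpos x hx).ne']
    ring
  have hfc : ContinuousOn (fun x : ℝ ↦ 1 / (2 * (y ^ 2 - 4 * x))) (Icc (0 : ℝ) T) := by
    refine continuousOn_const.div (continuousOn_const.mul (continuousOn_const.sub
      (continuousOn_const.mul continuousOn_id))) fun x hx ↦ ?_
    exact mul_ne_zero two_ne_zero (hpos x hx).ne'
  have hy2 : 0 < y ^ 2 := by linarith [hT0]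
  rw [intervalIntegral.integral_eq_sub_of_hasDerivAt hderiv (hfc.intervalIntegrable_of_Icc hT0), hF]
  simp only [mul_zero, sub_zero]
  rw [Real.log_div hy2.ne' (hpos T ⟨hT0, le_rfl⟩).ne']
  ring

/-- **Choice of the steering time**: for `y > 0` and any `q` there is `T` with `4T < y²` and
`(1/8) log (y²/(y² - 4T)) ≥ q` (`4T = y²(1 - e^{-8 max(q,0)})`). [folklore] -/
theorem exists_steerTime_c5 {y : ℝ} (hy : 0 < y) (q : ℝ) :
    ∃ T : ℝ≥0, 4 * (T : ℝ) < y ^ 2 ∧ q ≤ Real.log (y ^ 2 / (y ^ 2 - 4 * T)) / 8 := by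
  set m : ℝ := max q 0 with hm
  set r : ℝ := Real.exp (-(8 * m)) with hr
  have hr0 : 0 < r := Real.exp_pos _
  have hr1 : r ≤ 1 := Real.exp_le_one_iff.2 (by linarith [le_max_right q 0])
  have hy2 : 0 < y ^ 2 := by positivity
  have hT0 : 0 ≤ y ^ 2 * (1 - r) / 4 := by
    have : 0 ≤ 1 - r := by linarith
    positivity
  refine ⟨(y ^ 2 * (1 - r) / 4).toNNReal, ?_, ?_⟩
  · rw [Real.coe_toNNReal _ hT0]
    nlinarith [mul_pos hy2 hr0]
  · rw [Real.coe_toNNReal _ hT0]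
    have h1 : y ^ 2 - 4 * (y ^ 2 * (1 - r) / 4) = y ^ 2 * r := by ring
    rw [h1, div_mul_cancel_left₀ hy2.ne', Real.log_inv, hr, Real.log_exp]
    linarith [le_max_left q 0]

/-- **The steering integral.** For the image driver `U` of the zero driver under `N` (`b > 0`,
`p ≠ 0`, `u₁ > u_q`, `4u_q < y⋆²`): `∫_{(0, clock u_q]} (Im Z_s/|Z_s|²)²/2 ds` is at least
`log(y⋆²/(y⋆²-4u_q))/8`, `Z_s = g^U_s(N(iy⋆)) - U_s`: at `s = clock u`, `Z_s = h_u(iε) - h_u(0)`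
(`map_imageDriver_apply`, `map_zeroDriver_I_mul`, `imageDriver_clockNN`), the integrand is
`P⁴/(2b²d₁²(y⋆² - 4u))` (`sq_im_div_normSq_conjMap_c5`), and after the change of variables along
the clock (`integral_comp_invClock`, rate `(b d₁/P²)²`) one integrates `1/(2(y⋆² - 4u))`.
[cite: Lawler2005, §6.3] -/
theorem log_div_le_lintegral_steer_c5 {a b p : ℝ} {u₁ uq : ℝ≥0} {ys : ℝ} (hb : 0 < b) (hp : p ≠ 0)
    (hu : uq < u₁) (hys : 0 < ys) (huq : 4 * (uq : ℝ) < ys ^ 2) :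
    ENNReal.ofReal (Real.log (ys ^ 2 / (ys ^ 2 - 4 * uq)) / 8) ≤
      ∫⁻ s in Ioc (0 : ℝ) (clockNN (fun _ : ℝ≥0 ↦ (0 : ℝ)) p u₁ b uq),
        ENNReal.ofReal
          (((Loewner.map (imageDriver (fun _ : ℝ≥0 ↦ (0 : ℝ)) p u₁ a b) s.toNNReal
                (moebN a b p (I * ys)) -
              imageDriver (fun _ : ℝ≥0 ↦ (0 : ℝ)) p u₁ a b s.toNNReal).im /
            Complex.normSq
              (Loewner.map (imageDriver (fun _ : ℝ≥0 ↦ (0 : ℝ)) p u₁ a b) s.toNNReal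
                  (moebN a b p (I * ys)) -
                imageDriver (fun _ : ℝ≥0 ↦ (0 : ℝ)) p u₁ a b s.toNNReal)) ^ 2 / 2) := by
  set W₀ : ℝ≥0 → ℝ := fun _ ↦ (0 : ℝ)
  have hW : Continuous W₀ := continuous_const
  have hp' : p ≠ W₀ 0 := hp
  have hu₁ : (u₁ : WithTop ℝ≥0) < swallowingTime W₀ p := by
    rw [swallowingTime_zeroDriver_eq_top (a := (p : ℂ)) (by simpa using hp)]
    exact WithTop.coe_lt_top u₁
  set X := gap W₀ p u₁ with hXdef
  have hX : Continuous X := continuous_gap hW hp'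
  have hX0 : ∀ u, X u ≠ 0 := gap_ne_zero hW hp' hu₁
  have hb0 : b ≠ 0 := hb.ne'
  have hu₁0 : (0 : ℝ) ≤ (u₁ : ℝ) := u₁.coe_nonneg
  have huu₁ : (uq : ℝ) ≤ u₁ := NNReal.coe_le_coe.2 hu.le
  have hS : ((clockNN W₀ p u₁ b uq : ℝ≥0) : ℝ) = clock b X uq := coe_clockNN hW hp' hu₁ hb uq
  have hS0 : 0 ≤ clock b X uq := clock_nonneg hX hX0 hb0 uq.coe_nonneg
  have hPX : ∀ r ∈ Icc (0 : ℝ) uq, poleFlow p X r - X r = 0 := fun r hr ↦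
    poleFlow_gap_sub_gap hW hp' hu₁ (u := r) ⟨hr.1, hr.2.trans huu₁⟩
  -- the explicit integrand in the original time, clamped to be continuous on `ℝ`
  set δ : ℝ := ys ^ 2 - 4 * uq with hδ
  have hδ0 : 0 < δ := by rw [hδ]; linarith
  set G : ℝ → ℝ := fun u ↦
    poleFlow p X u ^ 4 / (2 * b ^ 2 * poleDeriv X u ^ 2 * max (ys ^ 2 - 4 * u) δ) with hG
  have hmax0 : ∀ u, 0 < max (ys ^ 2 - 4 * u) δ := fun u ↦ hδ0.trans_le (le_max_right _ _)
  have hmax : ∀ r : ℝ, r ≤ uq → max (ys ^ 2 - 4 * r) δ = ys ^ 2 - 4 * r := fun r hr ↦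
    max_eq_left (by rw [hδ]; linarith)
  have hGc : Continuous G := by
    refine ((continuous_poleFlow hX hX0).pow 4).div ((((continuous_const.mul
      ((continuous_poleDeriv hX hX0).pow 2))).mul
      ((continuous_const.sub (continuous_const.mul continuous_id)).max continuous_const)))
      fun u ↦ ?_
    exact mul_ne_zero (mul_ne_zero (mul_ne_zero two_ne_zero (pow_ne_zero 2 hb0))
      (pow_ne_zero 2 (poleDeriv_pos u).ne')) (hmax0 u).ne'
  have hGnn : ∀ u, 0 ≤ G u := fun u ↦ by
    have : 0 ≤ poleFlow p X u ^ 4 := by positivity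
    have := hmax0 u
    positivity
  -- the value of the integral in the original time
  have hval : ∫ s in (0 : ℝ)..clock b X uq, G (invClock b X u₁ s) =
      Real.log (ys ^ 2 / (ys ^ 2 - 4 * uq)) / 8 := by
    rw [integral_comp_invClock hX hX0 hb0 hu₁0 hGc ⟨uq.coe_nonneg, huu₁⟩,
      ← integral_inv_two_mul_sub_c5 uq.coe_nonneg huq]
    refine intervalIntegral.integral_congr fun r hr ↦ ?_
    rw [uIcc_of_le uq.coe_nonneg] at hr
    have hεr : ys ^ 2 - 4 * r ≠ 0 := by linarith [hr.2]
    have hXr : X r ≠ 0 := hX0 r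
    have hd : poleDeriv X r ≠ 0 := (poleDeriv_pos r).ne'
    simp only [hG, hmax r hr.2]
    rw [rate, sub_eq_zero.1 (hPX r hr)]
    field_simp
  -- pass to the Lebesgue integral and identify the integrand pointwise on `(0, S]`
  rw [hS]
  have hint : IntegrableOn (fun s ↦ G (invClock b X u₁ s)) (Ioc (0 : ℝ) (clock b X uq)) :=
    ((hGc.comp (continuous_invClock hX hX0 hb0 hu₁0)).integrableOn_Icc).mono_set Ioc_subset_Icc_self
  have h1 : ENNReal.ofReal (Real.log (ys ^ 2 / (ys ^ 2 - 4 * uq)) / 8) =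
      ∫⁻ s in Ioc (0 : ℝ) (clock b X uq), ENNReal.ofReal (G (invClock b X u₁ s)) := by
    rw [← hval, intervalIntegral.integral_of_le hS0,
      ofReal_integral_eq_lintegral_ofReal hint (ae_of_all _ fun s ↦ hGnn _)]
  refine (h1.trans (setLIntegral_congr_fun measurableSet_Ioc fun s hs ↦ ?_)).le
  congr 1
  -- the level `s = clock u`, `u ∈ [0, u_q]`
  have hmono := (strictMono_clock hX hX0 hb0).monotone
  have hs1 : s ∈ Icc 0 (clock b X u₁) := ⟨hs.1.le, hs.2.trans (hmono huu₁)⟩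
  set u := invClock b X u₁ s with hudef
  have hu0 : 0 ≤ u := (invClock_mem_Icc hX hX0 hb0 hu₁0 hs1).1
  have huuq : u ≤ uq := by
    have h := monotone_invClock hX hX0 hb0 hu₁0 hs.2
    rwa [invClock_clock hX hX0 hb0 hu₁0 ⟨by linarith [uq.coe_nonneg], by linarith⟩] at h
  have hcs : clock b X u = s :=
    clock_invClock_of_mem hX hX0 hb0 hu₁0
      (Ioo_subset_Icc_self (Icc_subset_Ioo_clock hX hX0 hb0 hs1))
  set uN : ℝ≥0 := u.toNNReal with huNdef
  have huN : (uN : ℝ) = u := Real.coe_toNNReal _ hu0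
  have huN1 : uN < u₁ := by
    rw [← NNReal.coe_lt_coe, huN]
    exact lt_of_le_of_lt huuq (NNReal.coe_lt_coe.2 hu)
  have hclockNN : clockNN W₀ p u₁ b uN = s.toNNReal := by
    apply NNReal.coe_injective
    rw [coe_clockNN hW hp' hu₁ hb, Real.coe_toNNReal _ hs.1.le, huN, hcs]
  -- the point `i y⋆` is alive at the original time `u`, and `g_u(i y⋆) = i√(y⋆² - 4u)`
  have h4u : 4 * (uN : ℝ) < ys ^ 2 := by rw [huN]; linarith
  have hdomW : I * ys ∈ domain W₀ uN := by
    rw [mem_domain_iff]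
    refine ⟨show 0 < (I * (ys : ℂ)).im by simpa using hys, ?_⟩
    refine lt_of_lt_of_le ?_ (le_swallowingTime_zeroDriver_I_mul hys)
    rw [WithTop.coe_lt_coe, ← NNReal.coe_lt_coe, huN, Real.coe_toNNReal _ (by positivity)]
    linarith
  obtain ⟨-, hmap⟩ := map_imageDriver_apply (a := a) hW hp' hu₁ hb huN1 hdomW
  rw [hclockNN, map_zeroDriver_I_mul hys h4u, huN] at hmap
  have hdrv : imageDriver W₀ p u₁ a b s.toNNReal = driver a b X u := by
    rw [← hclockNN, imageDriver_clockNN hW hp' hu₁ hb huN1.le, huN]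
  have hε : 0 < ys ^ 2 - 4 * u := by linarith
  rw [hmap, hdrv, sq_im_div_normSq_conjMap_c5 hb0 (hX0 u) (hPX u ⟨hu0, huuq⟩) (Real.sqrt_pos.2 hε),
    Real.sq_sqrt hε.le]
  simp only [hG, hmax u huuq]

/-- **SEMICIRCLE STEERING (registered stub `stub_steeringArc`, L3a-A).** For a `*`-hull `A` with a
point `z₀ ∈ A ∩ ℍ` off the imaginary axis and every level `q`, there are a continuous driving
function `U` with `U 0 = 0`, a time `S` and a point `a ∈ A ∩ ℍ` such that every point of `A` is
alive at time `S` under the Loewner chain of `U` and `∫_{(0,S]} (Im Z_s/|Z_s|²)²/2 ds ≥ q`,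
`Z_s = g^U_s(a) - U_s`: the chain is the semicircle from `0` to the first point `a` of `A` on the
circle through `0`, `z₀` orthogonal to `ℝ` — the image of the vertical slit under a real Möbius
map of `ℍ` fixing `0` (`LoewnerMoebiusImageChain`). Points of `A ∩ ℍ` pull back to points off the
slit; real points of `A` are nonzero, hence off the closed semicircle
(`Loewner.lt_swallowingTime_of_notMem_closure_hull_holds`); the integral is
`log_div_le_lintegral_steer_c5`. [cite: Lawler2005, §4.1, §6.3]
[cite: LawlerSchrammWerner2003Restriction, §8] -/
theorem stub_steeringArc :
    ∀ (A : Set ℂ), IsStarHull A → ∀ (z₀ : ℂ), z₀ ∈ A → 0 < z₀.im → z₀.re ≠ 0 → ∀ (q : ℝ),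
      ∃ (U : ℝ≥0 → ℝ) (S : ℝ≥0) (a : ℂ), Continuous U ∧ U 0 = 0 ∧ a ∈ A ∧ 0 < a.im ∧
        (∀ z ∈ A, (S : WithTop ℝ≥0) < Loewner.swallowingTime U z) ∧
        ENNReal.ofReal q ≤ ∫⁻ s in Set.Ioc (0 : ℝ) S,
          ENNReal.ofReal (((Loewner.map U s.toNNReal a - U s.toNNReal).im /
            Complex.normSq (Loewner.map U s.toNNReal a - U s.toNNReal)) ^ 2 / 2) := by
  intro A hA z₀ hz₀ hv₀ hx₀ q
  -- the Möbius map through `z₀` fixing `0`, and the curve `y ↦ N(iy)`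
  obtain ⟨a, b, p, y₁, hb, hp, habp, hy₁, hNy₁⟩ := exists_moebParams_c5 hv₀ hx₀
  set W₀ : ℝ≥0 → ℝ := fun _ ↦ (0 : ℝ)
  have hW : Continuous W₀ := continuous_const
  have hp' : p ≠ W₀ 0 := hp
  have hden : ∀ y : ℝ, (p : ℂ) - I * y ≠ 0 := fun y h ↦ hp (by simpa using congrArg Complex.re h)
  have hf : Continuous fun y : ℝ ↦ moebN a b p (I * y) := continuous_const.add
    (continuous_const.div (continuous_const.sub (continuous_const.mul continuous_ofReal)) hden)
  have hf0 : (fun y : ℝ ↦ moebN a b p (I * y)) 0 = 0 := by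
    show (a : ℂ) + b / ((p : ℂ) - I * ((0 : ℝ) : ℂ)) = 0
    rw [ofReal_zero, mul_zero, sub_zero, ← ofReal_div, ← ofReal_add, habp, ofReal_zero]
  have hfim : ∀ y : ℝ, 0 < y → 0 < ((fun y : ℝ ↦ moebN a b p (I * y)) y).im := fun y hy ↦
    im_moebN_pos hb (by simpa using hy)
  -- the first hit of `A` along the semicircle, the steering time and the horizon
  obtain ⟨ys, hys, -, hysA, hgap⟩ := exists_firstHit_c5 hA.isBoundedHull.isClosed hA.zero_notMem
    hf hf0 hy₁.le (show moebN a b p (I * y₁) ∈ A from hNy₁ ▸ hz₀)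
  obtain ⟨uq, huq, hq⟩ := exists_steerTime_c5 hys q
  set u₁ : ℝ≥0 := uq + 1 with hu₁def
  have hu : uq < u₁ := by rw [hu₁def]; exact lt_add_one uq
  have hu₁ : (u₁ : WithTop ℝ≥0) < swallowingTime W₀ p := by
    rw [swallowingTime_zeroDriver_eq_top (a := (p : ℂ)) (by simpa using hp)]
    exact WithTop.coe_lt_top u₁
  have hU0 : imageDriver W₀ p u₁ a b 0 = 0 := by
    rw [imageDriver_zero hW hp' hu₁ hb, show W₀ 0 = 0 from rfl, sub_zero]
    exact habp
  refine ⟨imageDriver W₀ p u₁ a b, clockNN W₀ p u₁ b uq, moebN a b p (I * ys),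
    continuous_imageDriver hW hp' hu₁ hb, hU0, hysA, im_moebN_pos hb (by simpa using hys),
    fun z hz ↦ ?_,
    (ENNReal.ofReal_le_ofReal hq).trans (log_div_le_lintegral_steer_c5 hb hp hu hys huq)⟩
  -- ALIVENESS: points of the slit hull pull back below the first hit
  have hslit : ∀ z' ∈ hull W₀ uq, z' = I * (z'.im : ℂ) ∧ 0 < z'.im ∧ z'.im < ys := by
    intro z' hz'
    obtain ⟨hre, him, hsq⟩ := re_eq_zero_of_mem_hull_zeroDriver_c5 hz'
    refine ⟨Complex.ext (by simp [hre]) (by simp), him, ?_⟩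
    by_contra hle
    push Not at hle
    nlinarith [mul_self_le_mul_self hys.le hle]
  rcases (hA.isBoundedHull.im_nonneg hz).lt_or_eq with hpos | hzero
  · -- a point of `ℍ`: `z = N z'` with `z'` in the Loewner domain of the slit at `u_q`
    obtain ⟨z', hz'H, rfl⟩ := moebN_surjOn (a := a) (p := p) hb (show 0 < z.im from hpos)
    have hz'dom : z' ∈ domain W₀ uq := by
      refine ⟨hz'H, fun hz'K ↦ ?_⟩
      obtain ⟨hz'eq, him, hlt⟩ := hslit z' hz'K
      exact hgap z'.im him hlt (by rw [← hz'eq]; exact hz)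
    exact ((mem_domain_iff _ _ _).1 (map_imageDriver_apply (a := a) hW hp' hu₁ hb hu hz'dom).1).2
  · -- a real point: nonzero, hence off the closed semicircle `N({iy : 0 ≤ y ≤ y⋆}) ⊇ K̄_S`
    have hx : z.re ≠ 0 := fun h ↦ hA.zero_notMem (by
      rwa [show z = 0 from Complex.ext (by simp [h]) (by simp [← hzero])] at hz)
    have hnot : ((z.re : ℝ) : ℂ) ∉
        closure (hull (imageDriver W₀ p u₁ a b) (clockNN W₀ p u₁ b uq)) := by
      rw [hull_imageDriver_eq hW hp' hu₁ hb hu]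
      refine ofReal_notMem_closure_of_subset_image_c5 hf hf0 hfim (Y := ys) ?_ hx
      rintro _ ⟨z', hz'K, rfl⟩
      obtain ⟨hz'eq, him, hlt⟩ := hslit z' hz'K
      exact ⟨z'.im, ⟨him.le, hlt.le⟩, by simp only; rw [← hz'eq]⟩
    rw [show z = ((z.re : ℝ) : ℂ) from Complex.ext (by simp) (by simp [← hzero])]
    refine lt_swallowingTime_of_notMem_closure_hull_holds (continuous_imageDriver hW hp' hu₁ hb)
      ?_ hnot
    rw [hU0, ofReal_zero]
    exact_mod_cast hx

end Summit.CriticalPhenomena.SAWScalingLimit.Theorems.SubseqIdentification.BoundaryAreaLaw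

end
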